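import Summits.SmoothPoincare4.SmoothPoincare4.Theorems.CylinderEntropyCylinderRungTwoFluxIdentity
import HarnessLib

/-!
# A non-separating cross-section of `S⁴ × ℝ` with a pocket has zero vertical flux

Registered helper `helper_fluxZeroOfPocket` (wave 1, brick W1b — the assembly) of line
`killing-flux` of the crux `CylinderEntropy.CylinderRungTwo` (stmt-SmoothPoincare4-7631).
Everything here is proved (no named facts); theorems only.

Let `N = {z ∈ ℝ⁶ | ∑_{i<5} zᵢ² = 1} = S⁴ × ℝ`, `M` a compact connected boundaryless `4`-manifold,
`ι : M → ℝ⁶` a smooth embedding with image in `N`, and `ν` a continuous unit normal field along `ι`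
tangent to `N`. Assume the two bricks W2 (`helper_farPointsJoined`: far points of `N` are joined
off a set of bounded height) and W1a (`helper_sidesDifferOfPocket`: with a pocket the two sides
`a₊, a₋` of the `±ν` push-offs differ) as hypotheses (both are landed theorems; here they are
taken verbatim as premises). If `ι(M)` does NOT separate the two ends of `N` (for every `R` some
point of height `≤ -R` is joined in `N ∖ ι(M)` to some point of height `≥ R`) and `N ∖ ι(M)` has a
*pocket* (a point not joined in `N ∖ ι(M)` to any point of height `≤ -R₀`), then the flux of the
vertical Killing field `e₅` through `M` vanishes: `∫_M ν₅ d(ι^* μH⁴) = 0`.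

*Proof.* Re-run the crossing count of the flux identity (`stub_fluxIdentity`) in degree zero.
By the multiplicity area formula (`lintegral_abs_nu5_eq_lintegral_encard`) and
`integral_nu5_eq_sub`, `∫_M ν₅ d(ι^*μHE⁴) = ∫ N₊ - ∫ N₋` with `N_±(p)` the number of preimages of
`p ∈ S⁴` under the shadow `σ = truncL ∘ ι` with `±ν₅ > 0`, and for a.e. `p ∈ S⁴` the fibre is
finite and regular (`hausdorffMeasure_shadow_critical_eq_zero`). For such `p`, the telescoping
count `low_sub_low_eq_sum` along the vertical line over `p` from height `-R'` to height `R'`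
(`R'` above all heights of `ι(M)` and above `R₀`) reads
`[L(p,-R')] - [L(p,R')] = d · ∑_{σ x = p} sign ν₅(x)`, `d = [a₋] - [a₊]`, where `L` is "joined in
`N ∖ ι(M)` to a point of height `≤ -R₀`". Far below is lower (`low_of_le`); WITHOUT separation far
above is ALSO lower: non-separation at level `R'` gives `a, b ∈ N`, `a₅ ≤ -R'`, `R' ≤ b₅`, joined in
`N ∖ ι(M)`, and `(p, R')` is joined to `b` by W2. Hence `d · ∑ sign ν₅ = 0`; the pocket gives
`d ≠ 0` by W1a, so `N₊(p) = N₋(p)` for a.e. `p`, the two area integrals agree, and the flux is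
`0` (Mathlib's `μH⁴` is a scalar multiple of `μHE⁴`).
-/

-- the prescribed namespace `Summit.SmoothPoincare4.SmoothPoincare4.…` repeats `SmoothPoincare4`
set_option linter.dupNamespace false

noncomputable section

open MeasureTheory Set Function Filter Module
open scoped Manifold ContDiff ENNReal Topology RealInnerProductSpace NNReal

namespace Summit.SmoothPoincare4.SmoothPoincare4.Theorems.CylinderRungTwo.KillingFlux

open Literature.Geometry.Riemannian
open Literature.Geometry.Lorentzian Literature.Geometry.Lorentzian.PseudoRiemannianMetric
open Literature.Geometry.Riemannian.SphericalCylinderEntropy (truncL truncL_apply)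
open Literature.Geometry.Manifold.CylinderSlice (axis padL castSucc_ne_five)

/-- **W1b: a non-separating cross-section with a pocket has zero vertical flux.** Given the bricks
W2 (far points of `N = S⁴ × ℝ` are joined off a set of bounded height) and W1a (with a pocket, the
two sides of the `±ν` push-offs differ) as hypotheses: for a compact connected boundaryless
`4`-manifold `M`, a smooth embedding `ι : M → N ⊂ ℝ⁶` whose image does not separate the two ends
of `N` and whose complement has a pocket, and any continuous unit normal field `ν` along `ι`
tangent to `N`, `∫_M ν₅ d(ι^* μH⁴) = 0`. Degree-zero crossing count: along the vertical line over
a.e. `p ∈ S⁴` both far ends are on the lower side (non-separation + W2), so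
`d · (N₊(p) - N₋(p)) = 0` with `d = [a₋] - [a₊] ≠ 0` (pocket + W1a); hence `N₊ = N₋` a.e. and
`∫ ν₅ = ∫ N₊ - ∫ N₋ = 0`. [folklore] -/
theorem helper_fluxZeroOfPocket : (∀ (A : Set (EuclideanSpace ℝ (Fin 6))) (R : ℝ), (∀ z ∈ A, |z 5| < R) → (∀ a b : EuclideanSpace ℝ (Fin 6), ∑ i : Fin 5, a (Fin.castSucc i) ^ 2 = 1 → ∑ i : Fin 5, b (Fin.castSucc i) ^ 2 = 1 → R ≤ a 5 → R ≤ b 5 → JoinedIn ({z : EuclideanSpace ℝ (Fin 6) | ∑ i : Fin 5, z (Fin.castSucc i) ^ 2 = 1} \ A) a b) ∧ (∀ a b : EuclideanSpace ℝ (Fin 6), ∑ i : Fin 5, a (Fin.castSucc i) ^ 2 = 1 → ∑ i : Fin 5, b (Fin.castSucc i) ^ 2 = 1 → a 5 ≤ -R → b 5 ≤ -R → JoinedIn ({z : EuclideanSpace ℝ (Fin 6) | ∑ i : Fin 5, z (Fin.castSucc i) ^ 2 = 1} \ A) a b)) → (∀ (M : Type) [TopologicalSpace M] [T2Space M] [SecondCountableTopology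 M] [ChartedSpace (EuclideanSpace ℝ (Fin 4)) M] [IsManifold (𝓡 4) ∞ M] [CompactSpace M] [MeasurableSpace M] [BorelSpace M] (ι ν : M → EuclideanSpace ℝ (Fin 6)), Manifold.IsSmoothEmbedding (𝓡 4) (𝓡 6) ∞ ι → (∀ x, ∑ i : Fin 5, ι x (Fin.castSucc i) ^ 2 = 1) → Continuous ν → (euclideanMetric (EuclideanSpace ℝ (Fin 6))).IsUnitNormal (𝓡 4) ι ν 1 → (∀ x, ∑ i : Fin 5, ν x (Fin.castSucc i) * ι x (Fin.castSucc i) = 0) → ∀ (R t₀ : ℝ) (aP aM : Prop), 0 < t₀ → (∀ x, ∀ t ∈ Set.Ioc (0 : ℝ) t₀, (fun z : EuclideanSpace ℝ (Fin 6) => (‖truncL z‖⁻¹ : ℝ) • (z - z (5 : Fin 6) • (axis : EuclideanSpace ℝ (Fin 6))) + z (5 : Fin 6) • (axis : EuclideanSpace ℝ (Fin 6))) (ι x + t • ν x) ∈ {z : EuclideanSpace ℝ (Fin 6) | ∑ i : Fin 5, z (Fin.castSucc i) ^ 2 = 1} \ Set.range ι ∧ ((∃ b : EuclideanSpace ℝ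 (Fin 6), (∑ i : Fin 5, b (Fin.castSucc i) ^ 2 = 1) ∧ b (5 : Fin 6) ≤ -R ∧ JoinedIn ({z : EuclideanSpace ℝ (Fin 6) | ∑ i : Fin 5, z (Fin.castSucc i) ^ 2 = 1} \ Set.range ι) ((fun z : EuclideanSpace ℝ (Fin 6) => (‖truncL z‖⁻¹ : ℝ) • (z - z (5 : Fin 6) • (axis : EuclideanSpace ℝ (Fin 6))) + z (5 : Fin 6) • (axis : EuclideanSpace ℝ (Fin 6))) (ι x + t • ν x)) b) ↔ aP)) → (∀ x, ∀ t ∈ Set.Ioc (0 : ℝ) t₀, (fun z : EuclideanSpace ℝ (Fin 6) => (‖truncL z‖⁻¹ : ℝ) • (z - z (5 : Fin 6) • (axis : EuclideanSpace ℝ (Fin 6))) + z (5 : Fin 6) • (axis : EuclideanSpace ℝ (Fin 6))) (ι x + t • (-ν x)) ∈ {z : EuclideanSpace ℝ (Fin 6) | ∑ i : Fin 5, z (Fin.castSucc i) ^ 2 = 1} \ Set.range ι ∧ ((∃ b : EuclideanSpace ℝ (Fin 6), (∑ i : Fin 5, b (Fin.castSucc i) ^ 2 = 1) ∧ b (5 :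 Fin 6) ≤ -R ∧ JoinedIn ({z : EuclideanSpace ℝ (Fin 6) | ∑ i : Fin 5, z (Fin.castSucc i) ^ 2 = 1} \ Set.range ι) ((fun z : EuclideanSpace ℝ (Fin 6) => (‖truncL z‖⁻¹ : ℝ) • (z - z (5 : Fin 6) • (axis : EuclideanSpace ℝ (Fin 6))) + z (5 : Fin 6) • (axis : EuclideanSpace ℝ (Fin 6))) (ι x + t • (-ν x))) b) ↔ aM)) → (∃ z : EuclideanSpace ℝ (Fin 6), ∑ i : Fin 5, z (Fin.castSucc i) ^ 2 = 1 ∧ z ∉ Set.range ι ∧ ∀ b : EuclideanSpace ℝ (Fin 6), ∑ i : Fin 5, b (Fin.castSucc i) ^ 2 = 1 → b 5 ≤ -R → ¬ JoinedIn ({z : EuclideanSpace ℝ (Fin 6) | ∑ i : Fin 5, z (Fin.castSucc i) ^ 2 = 1} \ Set.range ι) z b) → ¬ (aP ↔ aM)) → ∀ (M : Type) [TopologicalSpace M] [T2Space M] [SecondCountableTopology M] [ChartedSpace (EuclideanSpace ℝ (Fin 4)) M] [IsManifold (𝓡 4) ∞ M] [CompactSpace M] [ConnectedSpace M] [MeasurableSpace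 M] [BorelSpace M] (ι : M → EuclideanSpace ℝ (Fin 6)), Manifold.IsSmoothEmbedding (𝓡 4) (𝓡 6) ∞ ι → (∀ x, ∑ i : Fin 5, ι x (Fin.castSucc i) ^ 2 = 1) → (∀ R : ℝ, ∃ a b : EuclideanSpace ℝ (Fin 6), ∑ i : Fin 5, a (Fin.castSucc i) ^ 2 = 1 ∧ ∑ i : Fin 5, b (Fin.castSucc i) ^ 2 = 1 ∧ a 5 ≤ -R ∧ R ≤ b 5 ∧ JoinedIn ({z : EuclideanSpace ℝ (Fin 6) | ∑ i : Fin 5, z (Fin.castSucc i) ^ 2 = 1} \ Set.range ι) a b) → (∃ (z : EuclideanSpace ℝ (Fin 6)) (R : ℝ), ∑ i : Fin 5, z (Fin.castSucc i) ^ 2 = 1 ∧ z ∉ Set.range ι ∧ ∀ b : EuclideanSpace ℝ (Fin 6), ∑ i : Fin 5, b (Fin.castSucc i) ^ 2 = 1 → b 5 ≤ -R → ¬ JoinedIn ({z : EuclideanSpace ℝ (Fin 6) | ∑ i : Fin 5, z (Fin.castSucc i) ^ 2 = 1} \ Set.range ι) z b) → ∀ ν : M → EuclideanSpace ℝ (Fin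 6), Continuous ν → (euclideanMetric (EuclideanSpace ℝ (Fin 6))).IsUnitNormal (𝓡 4) ι ν 1 → (∀ x, ∑ i : Fin 5, ν x (Fin.castSucc i) * ι x (Fin.castSucc i) = 0) → ∫ x, ν x 5 ∂(Measure.comap ι (μH[4] : Measure (EuclideanSpace ℝ (Fin 6)))) = 0 := by
  intro hW2 hW1a M _ _ _ _ _ _ _ _ _ ι hι hιN hns hpk ν hνc hνn hνt
  obtain ⟨z, R, hzN, hzr, hpocket⟩ := hpk
  classical
  -- the multiplicity functions `N±` and the flux as a difference of two areas
  set σ : M → (EuclideanSpace ℝ (Fin 5)) := fun x => truncL (ι x) with hσ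
  have h5c : Continuous fun x => ν x 5 := (EuclideanSpace.proj (5 : Fin 6)).continuous.comp hνc
  have hPpos : MeasurableSet {x : M | 0 < ν x 5} := (isOpen_lt continuous_const h5c).measurableSet
  have hPneg : MeasurableSet {x : M | ν x 5 < 0} := (isOpen_lt h5c continuous_const).measurableSet
  obtain ⟨hmP, hIP⟩ := lintegral_abs_nu5_eq_lintegral_encard hι hιN hνc hνn hνt hPpos fun x hx => ne_of_gt hx
  obtain ⟨hmN, hIN⟩ := lintegral_abs_nu5_eq_lintegral_encard hι hιN hνc hνn hνt hPneg fun x hx => ne_of_lt hx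
  obtain ⟨hfinP, hfinN, hint⟩ := integral_nu5_eq_sub hι hνc hνn
  rw [hIP] at hfinP hint
  rw [hIN] at hfinN hint
  have hcrit := hausdorffMeasure_shadow_critical_eq_zero hι hιN hνc hνn hνt
  -- the two sides of the cross-section; with the pocket they differ (W1a)
  obtain ⟨t₀, ht₀, aP, aM, hPm, hMm⟩ := exists_side_constants hι hιN hνc hνn hνt R
  have hne : ¬ (aP ↔ aM) :=
    hW1a M ι ν hι hιN hνc hνn hνt R t₀ aP aM ht₀ hPm hMm ⟨z, hzN, hzr, hpocket⟩
  have hd0 : ((if aM then (1 : ℤ) else 0) - (if aP then (1 : ℤ) else 0)) ≠ 0 := by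
    by_cases haP : aP
    · by_cases haM : aM
      · exact absurd ⟨fun _ => haM, fun _ => haP⟩ hne
      · rw [if_neg haM, if_pos haP]; norm_num
    · by_cases haM : aM
      · rw [if_pos haM, if_neg haP]; norm_num
      · exact absurd ⟨fun h => absurd h haP, fun h => absurd h haM⟩ hne
  -- a bound on the heights of `ι(M)`
  have hιc : Continuous ι := hι.contMDiff.continuous
  have hcont : Continuous fun x => |ι x 5| :=
    continuous_abs.comp ((EuclideanSpace.proj (5 : Fin 6)).continuous.comp hιc)
  obtain ⟨B, hB⟩ := (isCompact_range hcont).bddAbove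
  have hB' : ∀ x, |ι x 5| ≤ B := fun x => hB ⟨x, rfl⟩
  have hB0 : 0 ≤ B := by
    obtain ⟨x₀⟩ := (inferInstance : Nonempty M)
    exact (abs_nonneg _).trans (hB' x₀)
  set R' : ℝ := max R B + 1 with hR'
  have hBR : B < R' := by rw [hR']; linarith [le_max_right R B]
  have hRR : R ≤ R' := by rw [hR']; linarith [le_max_left R B]
  -- WITHOUT separation, every point of `N` of height `≥ R'` is on the lower side (W2)
  have hAbove : ∀ w : EuclideanSpace ℝ (Fin 6), ∑ i : Fin 5, w (Fin.castSucc i) ^ 2 = 1 → R' ≤ w 5 →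
      (∃ b : EuclideanSpace ℝ (Fin 6), (∑ i : Fin 5, b (Fin.castSucc i) ^ 2 = 1) ∧ b (5 : Fin 6) ≤ -R ∧
        JoinedIn (({z : EuclideanSpace ℝ (Fin 6) | ∑ i : Fin 5, z (Fin.castSucc i) ^ 2 = 1} :
          Set (EuclideanSpace ℝ (Fin 6))) \ Set.range ι) w b) := by
    intro w hw hw5
    obtain ⟨a, b, ha, hb, ha5, hb5, hab⟩ := hns R'
    have hA : ∀ z ∈ range ι, |z 5| < R' := by
      rintro _ ⟨x, rfl⟩
      exact (hB' x).trans_lt hBR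
    have hwb := (hW2 (range ι) R' hA).1 w b hw hb hw5 hb5
    exact ⟨a, ha, by linarith, hwb.trans hab.symm⟩
  -- degree zero: over every `p ∈ S⁴` with finite regular fibre, `∑ sign ν₅ = 0`
  have hd : ∀ p : EuclideanSpace ℝ (Fin 5), ∑ i : Fin 5, p i ^ 2 = 1 → ∀ F : Finset M,
      (∀ x, x ∈ F ↔ truncL (ι x) = p) → (∀ x ∈ F, ν x 5 ≠ 0) →
      ∑ x ∈ F, (if 0 < ν x 5 then (1 : ℤ) else -1) = 0 := by
    intro p hp F hF hreg
    have hfree : ∀ s : ℝ, B < |s| → padL p + s • (axis : (EuclideanSpace ℝ (Fin 6))) ∉ range ι := by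
      intro s hs hmem
      obtain ⟨x, -, hxs⟩ := (vert_mem_range_iff ι p s).1 hmem
      have := hB' x
      rw [hxs] at this
      linarith
    have h₀ : padL p + (-R') • (axis : (EuclideanSpace ℝ (Fin 6))) ∉ range ι :=
      hfree _ (by rw [abs_neg, abs_of_pos] <;> linarith)
    have h₁ : padL p + R' • (axis : (EuclideanSpace ℝ (Fin 6))) ∉ range ι :=
      hfree _ (by rw [abs_of_pos] <;> linarith)
    have key := low_sub_low_eq_sum hι hιN hνn hνt (fun x t ht => (hPm x t ht).2)
      (fun x t ht => (hMm x t ht).2) ht₀ hp hF hreg _ (-R') R' (by linarith) h₀ h₁ rfl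
    -- all crossings lie between `-R'` and `R'`
    have hall : (F.filter fun x => -R' < ι x 5 ∧ ι x 5 < R') = F := by
      refine Finset.filter_true_of_mem fun x _ => ?_
      have := hB' x
      rw [abs_le] at this
      constructor <;> linarith
    rw [hall] at key
    -- far below AND far above are on the lower side
    have hlow : (∃ b : EuclideanSpace ℝ (Fin 6), (∑ i : Fin 5, b (Fin.castSucc i) ^ 2 = 1) ∧
        b (5 : Fin 6) ≤ -R ∧
        JoinedIn (({z : EuclideanSpace ℝ (Fin 6) | ∑ i : Fin 5, z (Fin.castSucc i) ^ 2 = 1} :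
          Set (EuclideanSpace ℝ (Fin 6))) \ Set.range ι)
          (padL p + (-R') • (axis : (EuclideanSpace ℝ (Fin 6)))) b) :=
      low_of_le ⟨vert_mem_Ncyl hp _, h₀⟩ (by rw [vert_apply_five]; linarith)
    have hup : (∃ b : EuclideanSpace ℝ (Fin 6), (∑ i : Fin 5, b (Fin.castSucc i) ^ 2 = 1) ∧
        b (5 : Fin 6) ≤ -R ∧
        JoinedIn (({z : EuclideanSpace ℝ (Fin 6) | ∑ i : Fin 5, z (Fin.castSucc i) ^ 2 = 1} :
          Set (EuclideanSpace ℝ (Fin 6))) \ Set.range ι)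
          (padL p + R' • (axis : (EuclideanSpace ℝ (Fin 6)))) b) :=
      hAbove _ (vert_mem_Ncyl hp _) (by rw [vert_apply_five])
    rw [if_pos hlow, if_pos hup, sub_self] at key
    exact (mul_eq_zero.1 key.symm).resolve_left hd0
  -- the shadow lands in the unit sphere
  have hσS : ∀ x, σ x ∈ Metric.sphere (0 : (EuclideanSpace ℝ (Fin 5))) 1 := fun x => by
    rw [mem_sphere_zero_iff_norm, EuclideanSpace.norm_eq, Real.sqrt_eq_one]
    simpa [hσ, truncL_apply, Real.norm_eq_abs, sq_abs] using hιN x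
  have hzero : ∀ (P : Set M) (p : (EuclideanSpace ℝ (Fin 5))), p ∉ Metric.sphere (0 : (EuclideanSpace ℝ (Fin
        5))) 1 →
      ((σ ⁻¹' {p} ∩ P).encard : ℝ≥0∞) = 0 := by
    intro P p hp
    have : σ ⁻¹' {p} ∩ P = ∅ := by
      ext x
      simp only [mem_inter_iff, mem_preimage, mem_singleton_iff, mem_empty_iff_false, iff_false,
        not_and]
      intro hx
      exact absurd (hx ▸ hσS x) hp
    rw [this, Set.encard_empty, ENat.toENNReal_zero]
  -- a.e. on `ℝ⁵`: `N₊ = N₋`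
  have hae : ∀ᵐ p ∂(μHE[4] : Measure (EuclideanSpace ℝ (Fin 5))),
      ((σ ⁻¹' {p} ∩ {x : M | 0 < ν x 5}).encard : ℝ≥0∞) =
        ((σ ⁻¹' {p} ∩ {x : M | ν x 5 < 0}).encard : ℝ≥0∞) := by
    filter_upwards [ae_lt_top hmP hfinP.ne, ae_lt_top hmN hfinN.ne,
      measure_eq_zero_iff_ae_notMem.1 hcrit] with p h1 h2 h3
    by_cases hpS : p ∈ Metric.sphere (0 : (EuclideanSpace ℝ (Fin 5))) 1
    swap
    · rw [hzero _ p hpS, hzero _ p hpS]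
    have hp : ∑ i : Fin 5, p i ^ 2 = 1 :=
      Literature.Geometry.Manifold.CylinderSlice.sum_sq_eq_one ⟨p, hpS⟩
    have hf₁ : (σ ⁻¹' {p} ∩ {x : M | 0 < ν x 5}).Finite :=
      Set.encard_lt_top_iff.1 (ENat.toENNReal_lt_top.1 h1)
    have hf₂ : (σ ⁻¹' {p} ∩ {x : M | ν x 5 < 0}).Finite :=
      Set.encard_lt_top_iff.1 (ENat.toENNReal_lt_top.1 h2)
    have hreg' : ∀ x, σ x = p → ν x 5 ≠ 0 := fun x hx h0 => h3 ⟨x, h0, hx⟩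
    have hfib : (σ ⁻¹' {p}).Finite := by
      refine (hf₁.union hf₂).subset fun x hx => ?_
      rcases lt_or_gt_of_ne (hreg' x hx) with h | h
      · exact Or.inr ⟨hx, h⟩
      · exact Or.inl ⟨hx, h⟩
    set F := hfib.toFinset with hF
    have hFmem : ∀ x, x ∈ F ↔ truncL (ι x) = p := fun x => by
      rw [hF, Set.Finite.mem_toFinset]; rfl
    have hreg : ∀ x ∈ F, ν x 5 ≠ 0 := fun x hx => hreg' x ((hFmem x).1 hx)
    have key := hd p hp F hFmem hreg
    -- identify the sets with filters of `F`
    have hset₁ : σ ⁻¹' {p} ∩ {x : M | 0 < ν x 5} = ↑(F.filter fun x => 0 < ν x 5) := by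
      ext x; simp [hFmem, hσ]
    have hset₂ : σ ⁻¹' {p} ∩ {x : M | ν x 5 < 0} = ↑(F.filter fun x => ν x 5 < 0) := by
      ext x; simp [hFmem, hσ]
    rw [Finset.sum_ite, Finset.sum_const, Finset.sum_const, nsmul_eq_mul, nsmul_eq_mul, mul_one,
      mul_neg, mul_one] at key
    have hfilt : (F.filter fun x => ¬ 0 < ν x 5) = F.filter fun x => ν x 5 < 0 :=
      Finset.filter_congr fun x hx => ⟨fun h => lt_of_le_of_ne (not_lt.1 h) (hreg x hx),
        fun h => not_lt.2 h.le⟩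
    rw [hfilt] at key
    have hcard : (F.filter fun x => 0 < ν x 5).card = (F.filter fun x => ν x 5 < 0).card := by omega
    rw [hset₁, hset₂, Set.encard_coe_eq_coe_finsetCard, Set.encard_coe_eq_coe_finsetCard, hcard]
  -- the flux w.r.t. `μHE` vanishes
  have hmainE : ∫ x, ν x 5 ∂(Measure.comap ι (μHE[4] : Measure (EuclideanSpace ℝ (Fin 6)))) = 0 := by
    rw [hint, lintegral_congr_ae hae, sub_self]
  -- convert `μH ↔ μHE`
  rw [hausdorffMeasure_eq_smul_euclidean (X := (EuclideanSpace ℝ (Fin 6))), Measure.comap_smul,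
    integral_smul_measure, hmainE, smul_zero]

end Summit.SmoothPoincare4.SmoothPoincare4.Theorems.CylinderRungTwo.KillingFlux

end
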